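import Literature.NumberTheory.CubicFields.DeloneFaddeevAutomorphisms
import Literature.NumberTheory.CubicFields.DeloneFaddeevFractionField
import Mathlib.FieldTheory.Fixed
import HarnessLib

/-!
# The stabilizer of an irreducible binary cubic form is finite, of order at most `3`

Topic `Literature/NumberTheory/CubicFields`; built on `DeloneFaddeevAutomorphisms.lean`
(`Stab_{GL₂(ℤ)}(f) ≅ Aut R(f)`) and `DeloneFaddeevFractionField.lean` (`K_f = Frac R(f)` is a cubic
number field for irreducible `f`).

Bhargava–Taniguchi–Thorne 2023, §2.4 (11) and §4.1 (29): the weights `1/|Stab(x)|` in Shintani's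
zeta functions, with "`|Aut(F)| = 1` if `F` is a non-Galois cubic field, `3` if `F` is a Galois
cubic field" for the maximal orders; for a general order `R` in a cubic field `F` one has
`Aut(R) ↪ Aut(F)`. This file proves, for `f` irreducible over `ℚ`:

* `RingOfForm.ringAutToFieldAut` — the injective group homomorphism `Aut R(f) ↪ Aut K_f` (extension
  of automorphisms to the field of fractions, Mathlib's `IsFractionRing.ringEquivOfRingEquivHom`);
* `RingOfForm.finite_ringAut`, `card_ringAut_le_three` — **`Aut R(f)` is finite of order `≤ 3 = [K_f : ℚ]`**;
* `finite_stabilizer`, **`card_stabilizer_le_three`**, `one_le_card_stabilizer` — the same for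
  `Stab_{GL₂(ℤ)}(f)`, so the Shintani weight `1/|Stab(f)|` of an irreducible form lies in `[1/3, 1]`.

## References

* M. Bhargava, T. Taniguchi, F. Thorne, *Improved error estimates for the Davenport–Heilbronn
  theorems*, Math. Ann. 389 (2024) = arXiv:2107.12819, §2.4 (11), §4.1 (29) [BhargavaTaniguchiThorne2023].
-/

namespace Literature.NumberTheory.CubicFields

namespace RingOfForm

open BinaryCubic

variable {f : BinaryCubic ℤ} [hf : Fact f.IsIrreducible]

/-- `K_f` is the fraction field of `R(f)` (instance form of `isFractionRing_ratAlgebra`). [folklore] -/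
instance : IsFractionRing (RingOfForm f) (RatAlgebra f) := isFractionRing_ratAlgebra

/-- **`Aut R(f) → Aut K_f`**: every automorphism of the order `R(f)` extends uniquely to its field of
fractions `K_f` (Mathlib's `IsFractionRing.ringEquivOfRingEquivHom`). [folklore] -/
noncomputable def ringAutToFieldAut (f : BinaryCubic ℤ) [Fact f.IsIrreducible] :
    RingAut (RingOfForm f) →* RingAut (RatAlgebra f) :=
  IsFractionRing.ringEquivOfRingEquivHom (RingOfForm f) (RatAlgebra f)

/-- The extension restricts to the given automorphism on `R(f)`. [folklore] -/
theorem ringAutToFieldAut_algebraMap (σ : RingAut (RingOfForm f)) (x : RingOfForm f) :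
    ringAutToFieldAut f σ (algebraMap (RingOfForm f) (RatAlgebra f) x) = algebraMap (RingOfForm f) (RatAlgebra f) (σ x) :=
  IsFractionRing.ringEquivOfRingEquiv_algebraMap σ x

/-- **`Aut R(f) ↪ Aut K_f` is injective.** [folklore] -/
theorem ringAutToFieldAut_injective : Function.Injective (ringAutToFieldAut f) := by
  intro σ τ h
  apply RingEquiv.ext
  intro x
  apply IsFractionRing.injective (RingOfForm f) (RatAlgebra f)
  rw [← ringAutToFieldAut_algebraMap, ← ringAutToFieldAut_algebraMap, h]

/-- Ring automorphisms of the number field `K_f` are `ℚ`-algebra automorphisms. [folklore] -/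
noncomputable def fieldAutToAlgEquiv (f : BinaryCubic ℤ) [Fact f.IsIrreducible] :
    RingAut (RatAlgebra f) → (RatAlgebra f ≃ₐ[ℚ] RatAlgebra f) :=
  fun e => AlgEquiv.ofRingEquiv (f := e) fun _ => by simp

/-- `fieldAutToAlgEquiv` is injective (same underlying map). [folklore] -/
theorem fieldAutToAlgEquiv_injective : Function.Injective (fieldAutToAlgEquiv f) := by
  intro e e' h
  apply RingEquiv.ext
  intro x
  have := congrArg (fun φ : RatAlgebra f ≃ₐ[ℚ] RatAlgebra f => φ x) h
  simpa [fieldAutToAlgEquiv] using this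

/-- **`Aut R(f)` is finite** for irreducible `f`. [folklore] -/
instance finite_ringAut : Finite (RingAut (RingOfForm f)) :=
  Finite.of_injective _ ((fieldAutToAlgEquiv_injective (f := f)).comp ringAutToFieldAut_injective)

/-- **`|Aut R(f)| ≤ 3 = [K_f : ℚ]`** for irreducible `f` (`|Aut(K/ℚ)| ≤ [K : ℚ]`, Mathlib's
`AlgEquiv.card_le`; BTT (29): `1` or `3` for the maximal order). [cite: BhargavaTaniguchiThorne2023, §4.1 (29) (|Aut F| for cubic fields)] -/
theorem card_ringAut_le_three : Nat.card (RingAut (RingOfForm f)) ≤ 3 := by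
  classical
  calc Nat.card (RingAut (RingOfForm f)) ≤ Nat.card (RatAlgebra f ≃ₐ[ℚ] RatAlgebra f) :=
        Nat.card_le_card_of_injective _ ((fieldAutToAlgEquiv_injective (f := f)).comp ringAutToFieldAut_injective)
    _ = Fintype.card (RatAlgebra f ≃ₐ[ℚ] RatAlgebra f) := Nat.card_eq_fintype_card
    _ ≤ Module.finrank ℚ (RatAlgebra f) := AlgEquiv.card_le
    _ = 3 := finrank_ratAlgebra_eq_three

/-- `1 ≤ |Aut R(f)|`. [folklore] -/
theorem one_le_card_ringAut : 1 ≤ Nat.card (RingAut (RingOfForm f)) :=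
  Nat.one_le_iff_ne_zero.mpr (Nat.card_pos (α := RingAut (RingOfForm f))).ne'

end RingOfForm

open RingOfForm

variable {f : BinaryCubic ℤ} [hf : Fact f.IsIrreducible]

/-- **`Stab_{GL₂(ℤ)}(f)` is finite** for irreducible `f` (it is `≅ Aut R(f)`). [folklore] -/
instance finite_stabilizer : Finite (MulAction.stabilizer (GL (Fin 2) ℤ) f) :=
  Finite.of_equiv _ (autEquivStab f).toEquiv

/-- **`|Stab_{GL₂(ℤ)}(f)| ≤ 3`** for irreducible `f` (BTT §2.4/(29): the weights `1/|Stab(x)|` of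
irreducible forms are `1` or `1/3`). [cite: BhargavaTaniguchiThorne2023, §4.1 (29) (|Aut| = 1 or 3 for orders in cubic fields)] -/
theorem card_stabilizer_le_three : Nat.card (MulAction.stabilizer (GL (Fin 2) ℤ) f) ≤ 3 := by
  rw [card_stabilizer_eq_card_ringAut]
  exact card_ringAut_le_three

/-- `1 ≤ |Stab(f)|`, so the Shintani weight `1/|Stab(f)|` lies in `[1/3, 1]`. [folklore] -/
theorem one_le_card_stabilizer : 1 ≤ Nat.card (MulAction.stabilizer (GL (Fin 2) ℤ) f) := by
  rw [card_stabilizer_eq_card_ringAut]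
  exact one_le_card_ringAut

end Literature.NumberTheory.CubicFields
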